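import Literature.AlgebraicGeometry.Resolution.ExceptionalCurveDegree
import Literature.AlgebraicGeometry.Resolution.PrimeDivisorIdeals
import Literature.AlgebraicGeometry.Motives.CartierDivisorOfIdealSheaf
import Literature.AlgebraicGeometry.Motives.ClosedSubvarietyOfPoint
import Summits.ResolutionOfSingularities.ResolutionOfSingularities.Theorems.HomologicalConductorNoZenoContractionExcCurves
import HarnessLib

/-!
# Crux `NoZenoR` (stmt-ResolutionOfSingularities-19943), slot 5 (B1) upstairs, UP-6 (incidence graph
# acyclic): the ONE-POINT BOUND `[κ(x) : κ(𝔪)] ≤ (E_{η′} · E_η)` at a common point `x` of two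
# exceptional curves ((o-H2), the degree side of LEMMA H)

OURS (cell res-hironaka, crux chain W4.4, seat res-D-pv-045 gen 8; object (o-H2) named by
res-L0-w44-plan-1 DESK WORD 8/9, 2026-08-27T19:19Z–19:20Z; consumer res-L0-w44-stub-3's
`…NoZenoIncidenceGraphAcyclic`); nothing here is a statement of the manuscript under review
(Hironaka 2017); AI-written, weaker than expert review.  SUPPORT-level, counted 0.  Def-free,
fact-free: Literature `Resolution/ExceptionalCurveDegree`, `Resolution/PrimeDivisorIdeals`,
`Motives/CartierDivisorOfIdealSheaf`, `Motives/ClosedSubvarietyOfPoint` + the lead's route-independent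
`…NoZenoContractionExcCurves` (for `not_specializes_of_height_eq`) only.

THE BOUND.  `π : X ⟶ Spec T` proper, `T` local, `X` integral locally Noetherian; `η ∈ excCurvePoints π`
(an integral exceptional curve `E_η = closure {η}`), `η′` a point NOT specialising to `η` (e.g. another
exceptional generic point, `not_specializes_of_mem_excCurvePoints_of_ne`), `x` a common specialisation of
`η` and `η′`, and `[E_{η′}] := CartierDivisor.ofIsEffectiveCartier (primeDivisorIdeal η′) hF` the
effective Cartier divisor of the prime divisor `E_{η′}` (when `𝓘_{η′}` is invertible, e.g. on a regular
`X`: `isEffectiveCartier_primeDivisorIdeal_of_isRegular`).  Then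
`[κ(x) : κ(𝔪)] ≤ excCurveDegree π [E_{η′}] η = ([E_{η′}] · E_η)`:
`residueDegree_ofPointPt_le_excCurveDegree` (in the literal summand currency of `excCurveDegree`, the
residue degree of the point of `E_η` over `x` along `E_η ⟶ X ⟶ Spec T`),
`residueDegree_le_excCurveDegree` (Mathlib's `Scheme.Hom.residueDegree π x`), and the positivity
`excCurveDegree_pos_of_specializes` / `excCurveDegree_pos_of_mem_closure_inter` (`> 0`).

THE PROOF is the body of `CartierDivisor.IsEffective.degree_pos` (Motives `CartierDivisorCurveDegree`)
keeping the residue-degree factor: through a factorisation `q : E_η ⟶ Spec κ(𝔪)`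
(`exists_fac_specResidueField`) `excCurveDegree π D η = deg_{κ(𝔪)} (D|_{E_η})`
(`excCurveDegree_eq_degree_of_fac`) `= Σ_y ord_y(D|_{E_η}) [κ(y) : κ(𝔪)]`, a finite sum of
non-negative terms since `D|_{E_η}` is an honest effective pull-back (`D` avoids `η` because
`η ∉ E_{η′}`); at the point `y` over `x` the local equation is not a unit (`x ∈ E_{η′} = Supp [E_{η′}]`,
`avoids_ofIsEffectiveCartier_iff`), `y` is a closed point of the one-dimensional `E_η` (`x ≠ η`), so
`ord_y ≥ 1` (`IsEffective.ordAt_pos`) and the `y`-term is `≥ [κ(y) : κ(𝔪)] = [κ(x) : κ(𝔪)] ≥ 1`.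

References: J. Lipman, *Rational singularities …*, Publ. Math. IHÉS 36 (1969), §10 (pp. 212–215),
§13 (p. 223) [`Lipman1969`]; W. Fulton, *Intersection Theory* (1998), Def. 1.4, Def. 2.3 [`Fulton1998`].
-/

noncomputable section

-- single-problem summit: the doubled namespace component `ResolutionOfSingularities` is forced
set_option linter.dupNamespace false

namespace Summit.ResolutionOfSingularities.ResolutionOfSingularities.Theorems.NoZeno.ExcCount

open CategoryTheory AlgebraicGeometry TopologicalSpace IsLocalRing
open Literature.AlgebraicGeometry.Resolution Literature.AlgebraicGeometry.Motives
open Literature.AlgebraicGeometry.Motives.RatFn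

universe u

section OnePoint

variable {T : Type u} [CommRing T] [IsLocalRing T] {X : Scheme.{u}} [IsIntegral X]
  [IsLocallyNoetherian X] (π : X ⟶ Spec (.of T))

omit [IsIntegral X] [IsLocallyNoetherian X] in
/-- Two distinct integral exceptional curves `E_η ≠ E_{η′}`: `η′` does not specialise to `η`
(both generic points have height `1`; the lead's `not_specializes_of_height_eq`, p560245).
[cite: Lipman1969, Section 12 (p. 220)] -/
theorem not_specializes_of_mem_excCurvePoints_of_ne {η η' : X} (hη : η ∈ excCurvePoints π)
    (hη' : η' ∈ excCurvePoints π) (hne : η ≠ η') : ¬ η' ⤳ η :=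
  not_specializes_of_height_eq hne (hη.2.trans hη'.2.symm) (by rw [hη.2]; exact ENat.coe_lt_top 1)

variable [IsProper π]

omit [IsIntegral X] [IsLocallyNoetherian X] [IsProper π] in
/-- **The point of `E_η` over a strict specialisation `x` of `η` is a CLOSED point of the curve `E_η`**
(height `0`): it is not the generic point, and `E_η` is one-dimensional. [cite: Lipman1969, Section 10 (p. 212)] -/
theorem height_ofPointPt_eq_zero {η x : X} (hη : η ∈ excCurvePoints π) (hx : η ⤳ x) (hxη : x ≠ η) :
    Order.height (ClosedSubvariety.ofPointPt η hx) = 0 := by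
  have hE1 := height_top_ofPoint_eq_one π hη
  have hne : ClosedSubvariety.ofPointPt η hx ≠ (⊤ : ↥(ClosedSubvariety.ofPoint X η).carrier) := by
    intro h
    apply hxη
    have hgen := ClosedSubvariety.genericPoint_ofPoint (X := X) η
    unfold ClosedSubvariety.genericPoint at hgen
    calc x = (ClosedSubvariety.ofPoint X η).ι (ClosedSubvariety.ofPointPt η hx) := rfl
      _ = (ClosedSubvariety.ofPoint X η).ι (⊤ : ↥(ClosedSubvariety.ofPoint X η).carrier) := by rw [h]
      _ = η := hgen
  have hlt : ClosedSubvariety.ofPointPt η hx < (⊤ : ↥(ClosedSubvariety.ofPoint X η).carrier) := by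
    refine lt_iff_le_not_ge.mpr ⟨le_top, fun h => hne ?_⟩
    -- `⊤ ≤ y` means `y ⤳ ⊤`; with `⊤ ⤳ y` (`le_top`) and `T₀` this forces `y = ⊤`
    exact ((Scheme.le_iff_specializes.mp
      (le_top : ClosedSubvariety.ofPointPt η hx ≤ (⊤ : ↥(ClosedSubvariety.ofPoint X η).carrier))).antisymm
      (Scheme.le_iff_specializes.mp h)).eq.symm
  have hfin : Order.height (ClosedSubvariety.ofPointPt η hx) < ⊤ :=
    lt_of_le_of_lt ((Order.height_mono hlt.le).trans_eq hE1) (ENat.coe_lt_top 1)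
  have h := Order.height_strictMono hlt hfin
  rw [hE1] at h
  exact Order.lt_one_iff.mp h

/-- **(o-H2) ONE-POINT BOUND, literal currency.**  `π : X ⟶ Spec T` proper (`T` local, `X` integral
locally Noetherian), `η ∈ excCurvePoints π`, `η′ ̸⤳ η`, `x` a common specialisation of `η` and `η′`,
`hF : IsEffectiveCartier 𝓘_{η′}`: the residue degree `[κ(x) : κ(𝔪)]` of the point of `E_η` over `x`
(the summand weight of `excCurveDegree`) is at most `([E_{η′}] · E_η)`.
[cite: Lipman1969, Section 10 (pp. 212–215) and Section 13 (p. 223); Fulton1998, Definition 1.4] -/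
theorem residueDegree_ofPointPt_le_excCurveDegree {η η' x : X} (hη : η ∈ excCurvePoints π)
    (hη' : ¬ η' ⤳ η) (hx : η ⤳ x) (hx' : η' ⤳ x) (hF : IsEffectiveCartier (primeDivisorIdeal η')) :
    ((((ClosedSubvariety.ofPoint X η).ι ≫ π).residueDegree (ClosedSubvariety.ofPointPt η hx) : ℕ) : ℤ) ≤
      excCurveDegree π (CartierDivisor.ofIsEffectiveCartier (primeDivisorIdeal η') hF) η := by
  -- the structure morphism of `E_η` over the residue field
  obtain ⟨q, hq⟩ := exists_fac_specResidueField π hη.1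
  haveI : IsIntegral (Over.mk q : SchemeOver (ResidueField T)).left :=
    inferInstanceAs (IsIntegral (ClosedSubvariety.ofPoint X η).carrier)
  haveI : IsProper (Over.mk q : SchemeOver (ResidueField T)).hom := isProper_of_fac_specResidueField π hq
  -- `D = [E_{η′}]` is effective and avoids `η`, so `D|_{E_η}` is the honest pull-back, effective
  have hDeff : (CartierDivisor.ofIsEffectiveCartier (primeDivisorIdeal η') hF).IsEffective :=
    CartierDivisor.isEffective_ofIsEffectiveCartier _ hF
  have hDη : (CartierDivisor.ofIsEffectiveCartier (primeDivisorIdeal η') hF).Avoids η :=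
    (CartierDivisor.avoids_ofIsEffectiveCartier_iff _ hF η).mpr (by rwa [mem_support_primeDivisorIdeal_iff])
  have hav : (CartierDivisor.ofIsEffectiveCartier (primeDivisorIdeal η') hF).Avoids
      ((ClosedSubvariety.ofPoint X η).ι (genericPoint (ClosedSubvariety.ofPoint X η).carrier)) := by
    have hgen := ClosedSubvariety.genericPoint_ofPoint (X := X) η
    unfold ClosedSubvariety.genericPoint at hgen
    rw [hgen]
    exact hDη
  -- `x ∈ E_{η′} = Supp D`: no local equation of `D` at `x` is a unit
  have hDx : ¬ (CartierDivisor.ofIsEffectiveCartier (primeDivisorIdeal η') hF).Avoids x := fun h =>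
    (CartierDivisor.avoids_ofIsEffectiveCartier_iff _ hF x).mp h
      ((mem_support_primeDivisorIdeal_iff η' x).mpr hx')
  -- `y`, the point of `E_η` over `x`, is a closed point of the one-dimensional `E_η`
  have hxη : x ≠ η := by
    rintro rfl
    exact hη' hx'
  have hE1 : Order.height (⊤ : ↥(ClosedSubvariety.ofPoint X η).carrier) = 1 := height_top_ofPoint_eq_one π hη
  have hy0 : Order.height (ClosedSubvariety.ofPointPt η hx) = 0 := height_ofPointPt_eq_zero π hη hx hxη
  have hcoh : Order.coheight (ClosedSubvariety.ofPointPt η hx) = 1 :=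
    CartierDivisor.coheight_eq_one_of_height_eq_zero (C := (Over.mk q : SchemeOver (ResidueField T)))
      hE1 hy0
  -- pass to the degree over `κ(𝔪)` of the honest pull-back `D' = D|_{E_η}`
  have key : excCurveDegree π (CartierDivisor.ofIsEffectiveCartier (primeDivisorIdeal η') hF) η =
      CartierDivisor.degree (Over.mk q : SchemeOver (ResidueField T))
        ((CartierDivisor.ofIsEffectiveCartier (primeDivisorIdeal η') hF).pullbackAvoiding
          (ClosedSubvariety.ofPoint X η).ι hav) := by
    rw [excCurveDegree_eq_degree_of_fac π hq]
    congr 1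
    exact CartierDivisor.pullbackRep_of_avoids _ _ hav
  rw [residueDegree_ι_comp_eq_of_fac π hq, key, CartierDivisor.degree_eq_finsum]
  set D' : CartierDivisor (Over.mk q : SchemeOver (ResidueField T)).left :=
    (CartierDivisor.ofIsEffectiveCartier (primeDivisorIdeal η') hF).pullbackAvoiding
      (ClosedSubvariety.ofPoint X η).ι hav with hD'
  have hD'eff : D'.IsEffective := hDeff.pullbackAvoiding (ClosedSubvariety.ofPoint X η).ι hav
  -- a chart of `D'` at `y`; its local equation is not a unit at `y`
  obtain ⟨i, hi⟩ := D'.covers (ClosedSubvariety.ofPointPt η hx)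
  have hi' : (ClosedSubvariety.ofPoint X η).ι (ClosedSubvariety.ofPointPt η hx) ∈
      (CartierDivisor.ofIsEffectiveCartier (primeDivisorIdeal η') hF).U i.1 := hi
  have hu : ¬ IsUnitAt ((ClosedSubvariety.ofPoint X η).ι (ClosedSubvariety.ofPointPt η hx))
      ((CartierDivisor.ofIsEffectiveCartier (primeDivisorIdeal η') hF).f i.1) :=
    fun h => hDx (CartierDivisor.Avoids.of_mem hi' h)
  have hu' : ¬ IsUnitAt (ClosedSubvariety.ofPointPt η hx) (D'.f i) :=
    hDeff.not_isUnitAt_pullbackAvoiding (ClosedSubvariety.ofPoint X η).ι hav i hi hu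
  have hord : 0 < D'.ordAt (ClosedSubvariety.ofPointPt η hx) := hD'eff.ordAt_pos hi hu' hcoh
  -- the finite sum of non-negative terms dominates its `y`-term, which dominates `[κ(y) : κ(𝔪)]`
  have hfin : (Function.support fun z : ↥(Over.mk q : SchemeOver (ResidueField T)).left => D'.ordAt z *
      ((toSpecOver (Over.mk q : SchemeOver (ResidueField T))).left.residueDegree z : ℤ)).Finite :=
    (CartierDivisor.finite_support_cycle D').subset (Function.support_mul_subset_left _ _)
  rw [finsum_eq_sum _ hfin]
  have hrpos : (0 : ℤ) <
      ((toSpecOver (Over.mk q : SchemeOver (ResidueField T))).left.residueDegree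
        (ClosedSubvariety.ofPointPt η hx) : ℤ) := by
    exact_mod_cast Nat.pos_of_ne_zero (CartierDivisor.residueDegree_toSpecOver_ne_zero hy0)
  have hterm : ((toSpecOver (Over.mk q : SchemeOver (ResidueField T))).left.residueDegree
        (ClosedSubvariety.ofPointPt η hx) : ℤ) ≤
      D'.ordAt (ClosedSubvariety.ofPointPt η hx) *
        ((toSpecOver (Over.mk q : SchemeOver (ResidueField T))).left.residueDegree
          (ClosedSubvariety.ofPointPt η hx) : ℤ) :=
    le_mul_of_one_le_left hrpos.le hord
  have hymem : (ClosedSubvariety.ofPointPt η hx : ↥(Over.mk q : SchemeOver (ResidueField T)).left) ∈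
      hfin.toFinset :=
    hfin.mem_toFinset.mpr (Function.mem_support.mpr (lt_of_lt_of_le hrpos hterm).ne')
  calc ((q.residueDegree (ClosedSubvariety.ofPointPt η hx) : ℕ) : ℤ)
      = ((toSpecOver (Over.mk q : SchemeOver (ResidueField T))).left.residueDegree
          (ClosedSubvariety.ofPointPt η hx) : ℤ) := rfl
    _ ≤ D'.ordAt (ClosedSubvariety.ofPointPt η hx) *
        ((toSpecOver (Over.mk q : SchemeOver (ResidueField T))).left.residueDegree
          (ClosedSubvariety.ofPointPt η hx) : ℤ) := hterm
    _ ≤ ∑ z ∈ hfin.toFinset, D'.ordAt z *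
        ((toSpecOver (Over.mk q : SchemeOver (ResidueField T))).left.residueDegree z : ℤ) :=
      Finset.single_le_sum (fun z _ => mul_nonneg (hD'eff.ordAt_nonneg z) (Nat.cast_nonneg _)) hymem

/-- **(o-H2), the consumer's binder order** (stub-3's `hH` of `isAcyclic_of_adj_iff`, minus the `h0` factor
supplied by o5's `h0_primeDivisorIdeal_toNat_le_residueDegree_ofPointPt`): `η ≠ η′` both exceptional,
`η ⤳ x`, `η′ ⤳ x`, `hF` ⊢ the literal-currency bound. [cite: Lipman1969, Section 13 (p. 223); Fulton1998, Definition 1.4] -/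
theorem residueDegree_ofPointPt_le_excCurveDegree_of_ne {η η' x : X} (hη : η ∈ excCurvePoints π)
    (hη' : η' ∈ excCurvePoints π) (hne : η ≠ η') (hx : η ⤳ x) (hx' : η' ⤳ x)
    (hF : IsEffectiveCartier (primeDivisorIdeal η')) :
    ((((ClosedSubvariety.ofPoint X η).ι ≫ π).residueDegree (ClosedSubvariety.ofPointPt η hx) : ℕ) : ℤ) ≤
      excCurveDegree π (CartierDivisor.ofIsEffectiveCartier (primeDivisorIdeal η') hF) η :=
  residueDegree_ofPointPt_le_excCurveDegree π hη (not_specializes_of_mem_excCurvePoints_of_ne π hη hη' hne)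
    hx hx' hF

omit [IsLocalRing T] [IsIntegral X] [IsLocallyNoetherian X] [IsProper π] in
/-- **The residue degree of the point of `E_η` over `x`, along `E_η ⟶ X ⟶ Spec T`, is
`[κ(x) : κ(𝔪)] = π.residueDegree x`** (`E_η ⟶ X` is a closed immersion, of residue degree `1`).
[folklore] -/
theorem residueDegree_ι_comp_ofPointPt {η x : X} (hx : η ⤳ x) :
    ((ClosedSubvariety.ofPoint X η).ι ≫ π).residueDegree (ClosedSubvariety.ofPointPt η hx) =
      π.residueDegree x := by
  rw [residueDegree_comp]
  have h1 : (ClosedSubvariety.ofPoint X η).ι.residueDegree (ClosedSubvariety.ofPointPt η hx) = 1 :=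
    residueDegree_eq_one_of_stalkMap_surjective _ _
      ((ClosedSubvariety.ofPoint X η).ι.stalkMap_surjective _)
  rw [h1, one_mul]
  rfl

omit [IsIntegral X] [IsLocallyNoetherian X] in
/-- **The point of `E_η` over a strict specialisation has positive residue degree** `[κ(x) : κ(𝔪)] ≥ 1`
(a closed point of a proper curve over the field `κ(𝔪)` has finite residue field extension).
[cite: Lipman1969, Section 10 (p. 212)] -/
theorem residueDegree_ofPointPt_pos {η x : X} (hη : η ∈ excCurvePoints π) (hx : η ⤳ x) (hxη : x ≠ η) :
    0 < ((ClosedSubvariety.ofPoint X η).ι ≫ π).residueDegree (ClosedSubvariety.ofPointPt η hx) := by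
  obtain ⟨q, hq⟩ := exists_fac_specResidueField π hη.1
  haveI : IsIntegral (Over.mk q : SchemeOver (ResidueField T)).left :=
    inferInstanceAs (IsIntegral (ClosedSubvariety.ofPoint X η).carrier)
  haveI : IsProper (Over.mk q : SchemeOver (ResidueField T)).hom := isProper_of_fac_specResidueField π hq
  rw [residueDegree_ι_comp_eq_of_fac π hq]
  exact Nat.pos_of_ne_zero (CartierDivisor.residueDegree_toSpecOver_ne_zero
    (C := (Over.mk q : SchemeOver (ResidueField T))) (height_ofPointPt_eq_zero π hη hx hxη))

/-- **(o-H2) ONE-POINT BOUND, `Scheme.Hom.residueDegree` currency**: with the hypotheses of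
`residueDegree_ofPointPt_le_excCurveDegree`, `[κ(x) : κ(𝔪)] = π.residueDegree x ≤ ([E_{η′}] · E_η)`.
[cite: Lipman1969, Section 13 (p. 223); Fulton1998, Definition 1.4] -/
theorem residueDegree_le_excCurveDegree {η η' x : X} (hη : η ∈ excCurvePoints π)
    (hη' : ¬ η' ⤳ η) (hx : η ⤳ x) (hx' : η' ⤳ x) (hF : IsEffectiveCartier (primeDivisorIdeal η')) :
    ((π.residueDegree x : ℕ) : ℤ) ≤
      excCurveDegree π (CartierDivisor.ofIsEffectiveCartier (primeDivisorIdeal η') hF) η := by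
  rw [← residueDegree_ι_comp_ofPointPt π hx]
  exact residueDegree_ofPointPt_le_excCurveDegree π hη hη' hx hx' hF

/-- **Positivity**: two curves through a common point meet positively — with the hypotheses of
`residueDegree_ofPointPt_le_excCurveDegree`, `0 < ([E_{η′}] · E_η)` (the in-tree replacement of the
strict form of Lipman (13.1) c) used by the incidence-graph argument).
[cite: Lipman1969, Proposition (13.1) c) (p. 223)] -/
theorem excCurveDegree_pos_of_specializes {η η' x : X} (hη : η ∈ excCurvePoints π)
    (hη' : ¬ η' ⤳ η) (hx : η ⤳ x) (hx' : η' ⤳ x) (hF : IsEffectiveCartier (primeDivisorIdeal η')) :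
    0 < excCurveDegree π (CartierDivisor.ofIsEffectiveCartier (primeDivisorIdeal η') hF) η := by
  have hxη : x ≠ η := by
    rintro rfl
    exact hη' hx'
  have h1 := residueDegree_ofPointPt_pos π hη hx hxη
  have h2 := residueDegree_ofPointPt_le_excCurveDegree π hη hη' hx hx' hF
  exact lt_of_lt_of_le (by exact_mod_cast h1) h2

/-- **Positivity, closure form**: for distinct exceptional generic points `η ≠ η′` and
`x ∈ closure {η} ∩ closure {η′}`, `0 < ([E_{η′}] · E_η)`. [cite: Lipman1969, Proposition (13.1) c) (p. 223)] -/
theorem excCurveDegree_pos_of_mem_closure_inter {η η' x : X} (hη : η ∈ excCurvePoints π)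
    (hη' : η' ∈ excCurvePoints π) (hne : η ≠ η') (hx : x ∈ closure {η} ∩ closure {η'})
    (hF : IsEffectiveCartier (primeDivisorIdeal η')) :
    0 < excCurveDegree π (CartierDivisor.ofIsEffectiveCartier (primeDivisorIdeal η') hF) η :=
  excCurveDegree_pos_of_specializes π hη (not_specializes_of_mem_excCurvePoints_of_ne π hη hη' hne)
    (specializes_iff_mem_closure.mpr hx.1) (specializes_iff_mem_closure.mpr hx.2) hF

/-- **One-point bound, closure form** (the shape LEMMA H is consumed in: `x ∈ closure{η} ∩ closure{η′}`,
`η ≠ η′` both exceptional): `π.residueDegree x ≤ ([E_{η′}] · E_η)`.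
[cite: Lipman1969, Section 13 (p. 223); Fulton1998, Definition 1.4] -/
theorem residueDegree_le_excCurveDegree_of_mem_closure_inter {η η' x : X} (hη : η ∈ excCurvePoints π)
    (hη' : η' ∈ excCurvePoints π) (hne : η ≠ η') (hx : x ∈ closure {η} ∩ closure {η'})
    (hF : IsEffectiveCartier (primeDivisorIdeal η')) :
    ((π.residueDegree x : ℕ) : ℤ) ≤
      excCurveDegree π (CartierDivisor.ofIsEffectiveCartier (primeDivisorIdeal η') hF) η :=
  residueDegree_le_excCurveDegree π hη (not_specializes_of_mem_excCurvePoints_of_ne π hη hη' hne)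
    (specializes_iff_mem_closure.mpr hx.1) (specializes_iff_mem_closure.mpr hx.2) hF

end OnePoint

end Summit.ResolutionOfSingularities.ResolutionOfSingularities.Theorems.NoZeno.ExcCount

end
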